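import Summits.NavierStokesRegularity.NavierStokesRegularity.Theorems.AxisymmetricExtremalityAxisymmetricKatoGlobalStubSeregin2020TypeIILemma22ParabolicBumps
import Summits.NavierStokesRegularity.NavierStokesRegularity.Theorems.AxisymmetricExtremalityAxisymmetricKatoGlobalStubSeregin2020TypeIILemma22VeryWeakAxis
import HarnessLib

/-!
# Seregin 2020, Lemma 2.2 (after Nazarov–Uraltseva 2012): the test function of N–U's (4.6) —
# a parabolic cut-off of `B_R × ]-R², -¾R²[`, its derivative bounds and its axis integral

Helper toward the stub `stub_seregin2020TypeII` of the crux `AxisymmetricKatoGlobal` (= the named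
fact `Literature.Analysis.FluidPDE.Seregin2020_axisymmetricSingularPoint_typeII`, G. Seregin,
Anal. Math. Phys. 10 (2020) Paper 46 = arXiv:2006.04140, Thm 2.1), reduced in the tree to the
corrected Lemma 2.2 (`hWH′`; Nazarov–Uraltseva 2012, Lemma 4.2 for the class 𝒱). In the proof of
Lemma 4.2 (N–U (4.6)) the very weak form is tested against `η` with "`η ≡ 1` in
`Q_R^{½,⅛}(0;-13R²/16)`, `η ≡ 0` out of `Q_R^{1,¼}(0;-¾R²)`, `|∂ₜη| + |Dη|² + |Δη| ≤ C/R²`". This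
file builds such an `η₀` from the tree's `cutoff` (inner fractions adapted so that the support
is STRICTLY inside `]-R², -¾R²[ × B_R`):
`η₀(t, x) = cutoff (R²/32) (t + 7R²/8) · cutoff (3R/8) x`.

* `axisTest_props` — `η₀` is a space–time test function on `{t < 0}`, `0 ≤ η₀ ≤ 1`, with
  `tsupport η₀ ⊆ [-15R²/16, -13R²/16] × B̄(0, 3R/4) ⊆ ]-R², -¾R²[ × B_R`;
* `exists_axisTest_deriv_bounds` — an absolute `C₀` with `|∂ₜη₀| ≤ C₀/R²`, `‖Dη₀‖ ≤ C₀/R`,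
  `|Δη₀| ≤ C₀/R²`;
* `axisTest_axis_integral_ge` — `3R³/64 ≤ ∫∫ η₀(t, (0,0,x₃)) dx₃ dt` (`η₀ = 1` on
  `[-29R²/32, -27R²/32] × {|x₃| ≤ 3R/8}`).

## References

* A. I. Nazarov, N. N. Uraltseva, St. Petersburg Math. J. 23 (2012) 93–115 = arXiv:1011.1888,
  proof of Lemma 4.2, the test function of (4.6). [NazarovUraltseva2012]
* G. Seregin, Anal. Math. Phys. 10 (2020), Paper 46 = arXiv:2006.04140, Lemma 2.2 (arXiv p. 8).
  [Seregin2020]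
-/

-- the problem directory repeats the summit name (D-0017); core's `dupNamespace` linter fires
set_option linter.dupNamespace false

noncomputable section

open MeasureTheory Set Function Filter Topology TopologicalSpace Metric
open scoped NNReal ENNReal InnerProductSpace Laplacian

namespace Summit.NavierStokesRegularity.NavierStokesRegularity.Theorems.AxisymmetricKatoGlobal.EulerScaling

open Literature.Analysis.FluidPDE

/-- **The test function of (4.6): support and range.** For `R > 0` and
`η₀(t,x) = cutoff (R²/32) (t + 7R²/8) · cutoff (3R/8) x`: `η₀` is a space–time test function on
the open half-space `{t < 0}`, `0 ≤ η₀ ≤ 1`, `η₀ = 1` where `|t + 7R²/8| ≤ R²/32` and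
`‖x‖ ≤ 3R/8`, and `tsupport η₀ ⊆ [-15R²/16, -13R²/16] × B̄(0, 3R/4)`. [cite: NazarovUraltseva2012, proof of Lemma 4.2, the test function of (4.6)] -/
theorem axisTest_props {R : ℝ} (hR : 0 < R) {η₀ : ℝ → EuclideanSpace ℝ (Fin 3) → ℝ}
    (hη₀ : ∀ t x, η₀ t x = cutoff (R ^ 2 / 32) (t + 7 * R ^ 2 / 8) * cutoff (3 * R / 8) x) :
    IsSpaceTimeTestOn ⟨{w : ℝ × EuclideanSpace ℝ (Fin 3) | w.1 < 0}, isOpen_lt continuous_fst continuous_const⟩ η₀ ∧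
    (∀ t x, 0 ≤ η₀ t x) ∧ (∀ t x, η₀ t x ≤ 1) ∧
    (∀ t x, |t + 7 * R ^ 2 / 8| ≤ R ^ 2 / 32 → ‖x‖ ≤ 3 * R / 8 → η₀ t x = 1) ∧
    tsupport (uncurry η₀) ⊆ Icc (-(15 * R ^ 2 / 16)) (-(13 * R ^ 2 / 16)) ×ˢ closedBall (0 : EuclideanSpace ℝ (Fin 3)) (3 * R / 4) := by
  have h32 : 0 < R ^ 2 / 32 := by positivity
  have h38 : 0 < 3 * R / 8 := by positivity
  have hfun : uncurry η₀ = fun z : ℝ × EuclideanSpace ℝ (Fin 3) =>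
      cutoff (R ^ 2 / 32) (z.1 + 7 * R ^ 2 / 8) * cutoff (3 * R / 8) z.2 := funext fun z => hη₀ z.1 z.2
  have hsmooth : ContDiff ℝ (⊤ : ℕ∞) (uncurry η₀) := by
    rw [hfun]
    exact ((contDiff_cutoff (R ^ 2 / 32)).comp (contDiff_fst.add contDiff_const)).mul
      ((contDiff_cutoff (3 * R / 8)).comp contDiff_snd)
  -- support
  have hzero : ∀ z : ℝ × EuclideanSpace ℝ (Fin 3),
      z ∉ Icc (-(15 * R ^ 2 / 16)) (-(13 * R ^ 2 / 16)) ×ˢ closedBall (0 : EuclideanSpace ℝ (Fin 3)) (3 * R / 4) →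
      uncurry η₀ z = 0 := by
    intro z hz
    rw [hfun]
    simp only
    rw [mem_prod, mem_Icc, mem_closedBall, dist_zero_right, not_and_or] at hz
    rcases hz with h | h
    · have : 2 * (R ^ 2 / 32) ≤ ‖z.1 + 7 * R ^ 2 / 8‖ := by
        rw [Real.norm_eq_abs]
        rcases not_and_or.1 h with h' | h'
        · rw [abs_of_neg (by linarith)]; linarith
        · rw [abs_of_pos (by linarith)]; linarith
      rw [cutoff_eq_zero h32 this, zero_mul]
    · have : 2 * (3 * R / 8) ≤ ‖z.2‖ := by linarith [not_le.1 h]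
      rw [cutoff_eq_zero h38 this, mul_zero]
  have htsupp : tsupport (uncurry η₀) ⊆
      Icc (-(15 * R ^ 2 / 16)) (-(13 * R ^ 2 / 16)) ×ˢ closedBall (0 : EuclideanSpace ℝ (Fin 3)) (3 * R / 4) := by
    refine closure_minimal (fun z hz => ?_) (isClosed_Icc.prod isClosed_closedBall)
    by_contra h
    exact hz (hzero z h)
  have hcs : HasCompactSupport (uncurry η₀) :=
    HasCompactSupport.intro (isCompact_Icc.prod (isCompact_closedBall _ _)) hzero
  have hW : tsupport (uncurry η₀) ⊆ {w : ℝ × EuclideanSpace ℝ (Fin 3) | w.1 < 0} := fun z hz => by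
    have h := (htsupp hz).1
    rw [mem_Icc] at h
    show z.1 < 0
    nlinarith [h.2]
  refine ⟨⟨hsmooth, hcs, hW⟩, fun t x => ?_, fun t x => ?_, fun t x ht hx => ?_, htsupp⟩
  · rw [hη₀]; exact mul_nonneg (cutoff_nonneg _ _) (cutoff_nonneg _ _)
  · rw [hη₀]; exact mul_le_one₀ (cutoff_le_one _ _) (cutoff_nonneg _ _) (cutoff_le_one _ _)
  · rw [hη₀, cutoff_eq_one h32 (by rwa [Real.norm_eq_abs]), cutoff_eq_one h38 hx, mul_one]

/-- **The test function of (4.6): scale-invariant derivative bounds.** There is an absolute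
`C₀ ≥ 0` with `|∂ₜη₀| ≤ C₀/R²`, `‖Dη₀‖ ≤ C₀/R`, `|Δη₀| ≤ C₀/R²` for every `R > 0`
(N–U: `|∂ₜη| + |Dη|² + |Δη| ≤ C/R²`). [cite: NazarovUraltseva2012, proof of Lemma 4.2, the test function of (4.6)] -/
theorem exists_axisTest_deriv_bounds : ∃ C₀ : ℝ, 0 ≤ C₀ ∧ ∀ (R : ℝ), 0 < R →
    ∀ (η₀ : ℝ → EuclideanSpace ℝ (Fin 3) → ℝ),
    (∀ t x, η₀ t x = cutoff (R ^ 2 / 32) (t + 7 * R ^ 2 / 8) * cutoff (3 * R / 8) x) →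
    ∀ (t : ℝ) (x : EuclideanSpace ℝ (Fin 3)),
      |deriv (fun s => η₀ s x) t| ≤ C₀ / R ^ 2 ∧ ‖fderiv ℝ (η₀ t) x‖ ≤ C₀ / R ∧ |(Δ (η₀ t)) x| ≤ C₀ / R ^ 2 := by
  obtain ⟨Ct, hCt0, hCt⟩ := exists_norm_fderiv_cutoff_le (E := ℝ)
  obtain ⟨C₁, hC₁0, hC₁⟩ := exists_norm_fderiv_cutoff_le (E := EuclideanSpace ℝ (Fin 3))
  obtain ⟨C₂, hC₂0, hC₂⟩ := exists_abs_laplacian_cutoff_le (E := EuclideanSpace ℝ (Fin 3))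
  refine ⟨max (32 * Ct) (max (8 / 3 * C₁) (64 / 9 * C₂)), le_max_of_le_left (by positivity), fun R hR η₀ hη₀ t x => ?_⟩
  have h32 : 0 < R ^ 2 / 32 := by positivity
  have h38 : 0 < 3 * R / 8 := by positivity
  have hR2 : 0 < R ^ 2 := by positivity
  have hηt : (fun s => η₀ s x) = fun s => cutoff (R ^ 2 / 32) (s + 7 * R ^ 2 / 8) * cutoff (3 * R / 8) x :=
    funext fun s => hη₀ s x
  have hηx : η₀ t = fun y => cutoff (R ^ 2 / 32) (t + 7 * R ^ 2 / 8) * cutoff (3 * R / 8) y := funext fun y => hη₀ t y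
  have ha1 : |cutoff (R ^ 2 / 32) (t + 7 * R ^ 2 / 8)| ≤ 1 := abs_cutoff_le_one _ _
  have hb1 : |cutoff (3 * R / 8) x| ≤ 1 := abs_cutoff_le_one _ _
  refine ⟨?_, ?_, ?_⟩
  · rw [hηt, deriv_mul_const_field, deriv_comp_add_const, abs_mul]
    have h1 : |deriv (cutoff (R ^ 2 / 32)) (t + 7 * R ^ 2 / 8)| ≤ Ct / (R ^ 2 / 32) := by
      rw [← Real.norm_eq_abs, norm_deriv_eq_norm_fderiv]; exact hCt _ h32 _
    calc |deriv (cutoff (R ^ 2 / 32)) (t + 7 * R ^ 2 / 8)| * |cutoff (3 * R / 8) x| ≤ Ct / (R ^ 2 / 32) * 1 :=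
          mul_le_mul h1 hb1 (abs_nonneg _) (div_nonneg hCt0 h32.le)
      _ = 32 * Ct / R ^ 2 := by field_simp
      _ ≤ _ := div_le_div_of_nonneg_right (le_max_left _ _) hR2.le
  · rw [hηx, fderiv_const_mul ((contDiff_cutoff (n := 1) (3 * R / 8)).differentiable one_ne_zero _)
      (cutoff (R ^ 2 / 32) (t + 7 * R ^ 2 / 8)), norm_smul, Real.norm_eq_abs]
    calc |cutoff (R ^ 2 / 32) (t + 7 * R ^ 2 / 8)| * ‖fderiv ℝ (cutoff (3 * R / 8)) x‖ ≤ 1 * (C₁ / (3 * R / 8)) :=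
          mul_le_mul ha1 (hC₁ _ h38 _) (norm_nonneg _) zero_le_one
      _ = 8 / 3 * C₁ / R := by field_simp
      _ ≤ _ := div_le_div_of_nonneg_right ((le_max_left _ _).trans (le_max_right _ _)) hR.le
  · rw [hηx]
    have e1 : (fun y : EuclideanSpace ℝ (Fin 3) => cutoff (R ^ 2 / 32) (t + 7 * R ^ 2 / 8) * cutoff (3 * R / 8) y) =
        cutoff (R ^ 2 / 32) (t + 7 * R ^ 2 / 8) • (cutoff (E := EuclideanSpace ℝ (Fin 3)) (3 * R / 8)) := by
      funext y; simp [smul_eq_mul]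
    rw [e1, InnerProductSpace.laplacian_smul _ (contDiff_cutoff (n := 2) (3 * R / 8)).contDiffAt, smul_eq_mul, abs_mul]
    calc |cutoff (R ^ 2 / 32) (t + 7 * R ^ 2 / 8)| * |(Δ (cutoff (E := EuclideanSpace ℝ (Fin 3)) (3 * R / 8))) x| ≤
        1 * (C₂ / (3 * R / 8) ^ 2) := mul_le_mul ha1 (hC₂ _ h38 _) (abs_nonneg _) zero_le_one
      _ = 64 / 9 * C₂ / R ^ 2 := by field_simp; ring
      _ ≤ _ := div_le_div_of_nonneg_right ((le_max_right _ _).trans (le_max_right _ _)) hR2.le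

/-- **The axis integral of the test function**: `3R³/64 ≤ ∫∫ η₀(t,(0,0,x₃)) dx₃ dt` (`η₀ = 1` on
the rectangle `[-29R²/32, -27R²/32] × [-3R/8, 3R/8]` of the axis plane, of area `(R²/16)(3R/4)`;
N–U: the left-hand side `(π/2)kR³` of (4.6)). [cite: NazarovUraltseva2012, proof of Lemma 4.2, (4.6)] -/
theorem axisTest_axis_integral_ge {R : ℝ} (hR : 0 < R) {η₀ : ℝ → EuclideanSpace ℝ (Fin 3) → ℝ}
    (hη₀ : ∀ t x, η₀ t x = cutoff (R ^ 2 / 32) (t + 7 * R ^ 2 / 8) * cutoff (3 * R / 8) x) :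
    3 * R ^ 3 / 64 ≤ ∫ p : ℝ × ℝ, η₀ p.1 (meridianPoint (0, p.2)) := by
  obtain ⟨htest, h0, -, h1, -⟩ := axisTest_props hR hη₀
  set Rect : Set (ℝ × ℝ) := Icc (-(7 * R ^ 2 / 8) - R ^ 2 / 32) (-(7 * R ^ 2 / 8) + R ^ 2 / 32) ×ˢ Icc (-(3 * R / 8)) (3 * R / 8)
    with hRect
  have hRm : MeasurableSet Rect := measurableSet_Icc.prod measurableSet_Icc
  have hRvol : volume Rect = ENNReal.ofReal (3 * R ^ 3 / 64) := by
    have hpos : 0 ≤ -(7 * R ^ 2 / 8) + R ^ 2 / 32 - (-(7 * R ^ 2 / 8) - R ^ 2 / 32) := by nlinarith [sq_nonneg R]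
    rw [hRect, Measure.volume_eq_prod, Measure.prod_prod, Real.volume_Icc, Real.volume_Icc,
      ← ENNReal.ofReal_mul hpos]
    congr 1; ring
  have hRfin : volume Rect < ∞ := by rw [hRvol]; exact ENNReal.ofReal_lt_top
  have hint : Integrable fun p : ℝ × ℝ => η₀ p.1 (meridianPoint (0, p.2)) :=
    integrable_comp_axis (F := uncurry η₀) htest.contDiff.continuous htest.hasCompactSupport
  have hle : (Rect.indicator fun _ => (1 : ℝ)) ≤ᵐ[volume] fun p : ℝ × ℝ => η₀ p.1 (meridianPoint (0, p.2)) := by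
    refine Eventually.of_forall fun p => ?_
    by_cases hp : p ∈ Rect
    · rw [indicator_of_mem hp]
      rw [hRect, mem_prod, mem_Icc, mem_Icc] at hp
      refine (h1 p.1 (meridianPoint (0, p.2)) ?_ ?_).symm.le
      · rw [abs_le]; constructor <;> linarith [hp.1.1, hp.1.2]
      · rw [norm_meridianPoint_zero, abs_le]; exact ⟨hp.2.1, hp.2.2⟩
    · rw [indicator_of_notMem hp]; exact h0 _ _
  have h := integral_mono_ae ((integrableOn_const (C := (1 : ℝ)) hRfin.ne).integrable_indicator hRm) hint hle
  rw [integral_indicator_const _ hRm, smul_eq_mul, mul_one, measureReal_def, hRvol,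
    ENNReal.toReal_ofReal (by positivity)] at h
  exact h

end Summit.NavierStokesRegularity.NavierStokesRegularity.Theorems.AxisymmetricKatoGlobal.EulerScaling

end
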